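import Mathlib
import HarnessLib

/-!
# Rigorous up-sampling of certified `L`-function data: the Whittaker–Shannon sampling theorem
# and Weiss's aliasing bound (Platt, Math. Comp. 85 (2016), §8, Theorems 8.1 and 8.2) — PROVED

Topic `Literature/NumberTheory/LFunctions`; namespace `Literature.NumberTheory.LFunctions`, with the
Fourier-analytic engine in the grouping namespace `Literature.NumberTheory.LFunctions.Upsampling`.
Companion of `DirichletLRiemannHypothesisUpTo.lean` (`platt2016_theorem71/72`: GRH for primitive
`χ` mod `q ≤ 400 000` to height `10⁸/q`, certified numerics) and of the Turing-method files
`CertifiedDirichletLTuring*.lean` (the zero-COUNTING half of Platt's certificate). This file types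
— and proves in the kernel — the zero-LOCATING half: §8 "Rigorous up-sampling" of

* D. J. Platt, *Numerical computations concerning the GRH*, Math. Comp. **85** (2016) 3009–3027
  [Platt2016GRH], §8 pp. 3020–3023 (journal pdf read 2026-08-27, `paper:url-20e4f76cdba6` pp. 12–15;
  = arXiv:1305.3087v1 §6, Theorems 6.1/6.2).

Platt's algorithms (§§6–7 of the paper) output a lattice of values `Λ_χ(n/A)` of the completed
`L`-function; "at any reasonable sampling rate, we expect to miss sign changes of `Λ_χ` and thus
pairs of zeros. We employ a rigorous up-sampling technique based on theorems of Whittaker–Shannon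
and Weiss to resolve such cases" (p. 3020). The two theorems, quoted:

* **Theorem 8.1 (Whittaker–Shannon Sampling Theorem)** (p. 3020). "Let `f(t)` be a continuous,
  real-valued function with Fourier Transform `f̂(x)` such that `f̂(x) = 0` for `|x| > A/2 > 0`.
  Also, define `sinc(x) := sin(x)/x`. Then `f(t) = Σ_{n ∈ ℤ} f(n/A) sinc(nπ − πAt)`, when this sum
  converges. Proof. See [19]." (= Walker, *Fast Fourier transforms*, 1991.)
* **Theorem 8.2 (Weiss)** (p. 3021). "Let `f(t)` be a real-valued function with Fourier Transform
  `f̂(x) := (1/2π) ∫_{−∞}^{∞} f(t) exp(−itx) dt` such that (1) `∫ |f̂(x)| dx < ∞`, (2) `f̂(x)` is of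
  bounded variation on `ℝ`, (3) when `f̂` has a jump discontinuity at `x` then
  `f̂(x) = lim_{ε→0⁺} (f̂(x−ε) + f̂(x+ε))/2`. Then
  `|f(t) − Σ_{n ∈ ℤ} f(n/A) sinc(nπ − πAt)| ≤ 4 ∫_{πA}^{∞} |f̂(x)| dx`. Proof. See, for example,
  [5]."
  (= J. L. Brown, J. Math. Anal. Appl. **18** (1967) 75–84, Theorem 1, which proves Weiss's 1963
  announcement without hypotheses (2)–(3); held as `paper:doi-10-1016-0022-247x-67-90183-7`.)

Neither theorem is in Mathlib or elsewhere in the tree (`lean search` 2026-08-27: only the truncated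
cardinal series `Literature.Analysis.Quadrature.cardinalSum` of Davis–Rabinowitz §3.4.6, without the
sampling identity). Both are PROVED here from Mathlib (no named facts; standard axioms).

## What is typed, and how it is proved

Normalisations. Mathlib's `𝓕 f (ξ) = ∫ f(t) e^{−2πiξt} dt` (ordinary frequency `ξ`); Platt's
`f̂(x) = (1/2π)∫ f(t)e^{−itx} dt` (angular frequency `x`, p. 3011 and Thm. 8.2) is written out as
the integral `(1/2π) ∫ f(t) e^{−itx} dt` wherever the printed form is typed, and
`f̂(x) = (1/2π)·𝓕 f (x/2π)` (`Upsampling.plattFourier_eq`; no new transform is defined). Samples at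
spacing `1/T` (Platt's `A = T`) see the spectrum `F` only through its `T`-periodisation
`P_T F(ξ) = Σ_{k ∈ ℤ} F(ξ + kT)` (written out as `∑' k : ℤ, F (ξ + k * T)`; ordinary frequency);
the sharp band is `|ξ| ≤ T/2`, i.e. `|x| ≤ πT` in Platt's letters.

* `Upsampling.hasSum_conj_fourierCoeffOn_mul_fourierCoeffOn` — Parseval's identity in inner-product
  form on a window `(a, b]`, from Mathlib's Hilbert basis `fourierBasis` of `L²(AddCircle (b − a))`.
* `Upsampling.fourierCoeffOn_cexp_neg` — the Fourier coefficients of `ξ ↦ e^{−2πitξ}` on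
  `(−T/2, T/2]` are `sinc(π(Tt + n))`.
* `Upsampling.hasSum_sinc_mul_windowIntegral` — the CORE IDENTITY: for `P ∈ L²(−T/2, T/2]` and
  `g(t) = ∫_{−T/2}^{T/2} e^{2πitξ} P(ξ) dξ`, `HasSum (n ↦ sinc(π(Tt − n)) · g(n/T)) (g t)`
  (unconditional = absolute convergence, by Cauchy–Schwarz inside Mathlib's `HasSum`).
* `whittakerShannon_hasSum` — **Theorem 8.1, sharp form, PROVED**: `f : ℝ → ℂ` continuous and
  integrable with `𝓕 f (ξ) = 0` for `|ξ| > T/2` ⇒ `HasSum (n ↦ f(n/T)·sinc(π(Tt − n))) (f t)` for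
  every `t` (Fourier inversion `Continuous.fourierInv_fourier_eq` + the core identity with
  `P = 𝓕 f`). `platt2016_theorem81` — the statement AS PRINTED (`f̂(x) = 0` for
  `|x| > A/2`, `f̂` Platt's transform, conclusion `Σ f(n/A) sinc(nπ − πAt) = f(t)`), a corollary
  since `A/2 < πA`; the
  convergence clause "when this sum converges" is proved, not assumed; `f` may be complex-valued.
* `Upsampling.hasSum_intervalIntegral_comp_add_zsmul` (`∫_ℝ G = Σ_k ∫_a^{a+T} G(· + kT)`),
  `Upsampling.fourierInv_sample_eq_windowIntegral_periodization` (`𝓕⁻F(n/T) = ∫_{−T/2}^{T/2}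
  e^{2πi(n/T)ξ} P_T F(ξ) dξ` for every integrable `F` — the aliasing mechanism),
  `Upsampling.norm_fourierInv_sub_windowIntegral_periodization_le` (`‖𝓕⁻F(t) − ∫_{−T/2}^{T/2}
  e^{2πitξ} P_T F‖ ≤ 2 ∫_{ξ ∉ (−T/2,T/2]} ‖F‖`, every integrable `F`).
* `Upsampling.exists_summable_cell_bound_of_boundedVariationOn` — hypotheses (1)+(2) of Thm. 8.2
  (`F ∈ L¹`, bounded variation on `ℝ`) give summable sup-bounds `‖F(ξ + kT)‖ ≤ M_k` on the window
  (`M_k = T⁻¹∫_{cell} ‖F‖ + Var(F; cell)`, super-additivity `Upsampling.sum_eVariationOn_cells_le`),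
  whence `P_T F` is bounded, so in `L²` of the window (`Upsampling.memLp_periodization`).
* `platt2016_theorem82` — **Theorem 8.2 PROVED** over `𝓕`: `f` continuous, integrable,
  (1) `𝓕 f ∈ L¹`, (2) `𝓕 f` of bounded variation on `ℝ` ⇒ the cardinal series at spacing `1/A` is
  summable and `‖f(t) − Σ' f(n/A) sinc(nπ − πAt)‖ ≤ 2 ∫_{ξ ∉ (−A/2, A/2]} ‖𝓕 f‖`;
  `platt2016_theorem82_real` — for real `f` with the PRINTED hypotheses on Platt's `f̂`
  ((1) integrable, (2) bounded variation; transferred to `𝓕 f` by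
  `Upsampling.integrable_fourier_of_plattFourier`,
  `Upsampling.boundedVariationOn_fourier_of_plattFourier`) and the PRINTED right-hand side
  `4 ∫_{πA}^∞ |f̂(x)| dx` (`Upsampling.integral_Ioi_norm_plattFourier`, Hermitian symmetry of `𝓕 f`
  for real `f`). The general complex form with hypothesis "summable cell bounds" is
  `norm_sub_tsum_sample_mul_sinc_le_of_cell_bound` /
  `Upsampling.norm_fourierInv_sub_tsum_sample_mul_sinc_le`.

* Truncation (the first of Platt's "two sources of error", p. 3021, "dealt with on a case-by-case
  basis"): `Upsampling.hasSum_sinc_sq` (`Σ_n sinc(π(Tt − n))² = 1`),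
  `Upsampling.hasSum_norm_sq_windowIntegral` / `whittakerShannon_hasSum_norm_sq` (Parseval for the
  samples: `Σ_n ‖f(n/T)‖² = T ∫_{−T/2}^{T/2} ‖𝓕 f‖²`) and the generic Cauchy–Schwarz certificate
  `whittakerShannon_truncation_sq_le`: `‖f(t) − Σ_{n∈s} f(n/T) sinc(π(Tt − n))‖² ≤
  (T∫‖𝓕 f‖² − Σ_{n∈s} ‖f(n/T)‖²)(1 − Σ_{n∈s} sinc(π(Tt − n))²)` for every finite `s ⊂ ℤ`.

Design notes. (i) The source's standing assumptions are made explicit: `f` continuous and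
integrable, so that `f̂` is the absolutely convergent integral and `f = 𝓕⁻ f̂` pointwise; then
hypothesis (3) of Thm. 8.2 is vacuous (`𝓕 f` is continuous) and is omitted — nothing is weakened.
(ii) The constant: for complex `f` the proof gives `2 ∫_{|ξ| ∉ window} ‖𝓕 f‖`, which for real `f`
is exactly the printed `4 ∫_{A/2}^∞ ‖𝓕 f‖ = 4 ∫_{πA}^∞ |f̂|` (Brown 1967 shows the constant is
sharp).
(iii) In Thm. 8.1 the journal prints the band as `|x| ≤ A/2`; with the angular convention of its §3
the sharp band for spacing `1/A` is `|x| ≤ πA ⊇ [−A/2, A/2]`, so the printed statement is the weaker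
one and follows from the sharp `whittakerShannon_hasSum` (arXiv v1 Thm. 6.1 prints the sharp pair
`|x| ≤ 2πB`, spacing `1/2B`).

Deliberately NOT here: Brown's Theorem 1 in full (`F ∈ L¹` only, no bounded variation: needs the
bounded pointwise convergence of the Fourier series of the saw-tooth, absent from Mathlib) —
TODO(general form); Platt's Lemmas 8.3–8.7 (Gaussian-window error terms specific to `Λ_χ`) and the
parameter choices of §9 — the lemmas are PROVED in the companion files
`CertifiedLFunctionGammaFactorBound.lean` (8.3), `CertifiedLFunctionGaussianWindow.lean` (8.4),
`CertifiedLFunctionWindowAliasingBound.lean` (8.5) and `CertifiedLFunctionUpsamplingTruncation.lean`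
(8.6–8.7, the truncation of this file's cardinal series for `W(t, χ)`, in the form the printed proof
yields; state 2026-08-27); the Weiss 1963 announcement itself (Notices AMS 10, p. 13, not held).

## References

* [Platt2016GRH] D. J. Platt, *Numerical computations concerning the GRH*, Math. Comp. 85 (2016),
  no. 302, 3009–3027, §8 Theorems 8.1, 8.2 pp. 3020–3021; §3 p. 3011 (Fourier convention).
* J. L. Brown, Jr., *On the error in reconstructing a non-bandlimited function by means of the
  bandpass sampling theorem*, J. Math. Anal. Appl. 18 (1967) 75–84, Theorem 1 (Platt's [5]).
* J. S. Walker, *Fast Fourier Transforms*, CRC Press 1991 (Platt's [19]/[20] for Thm. 8.1).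
-/

noncomputable section

open Complex Set MeasureTheory intervalIntegral Filter AddCircle
open scoped Real FourierTransform ComplexConjugate Topology

namespace Literature.NumberTheory.LFunctions

namespace Upsampling

/-! ## Parseval pairing on a window and the sinc coefficients -/

/-- **Parseval's identity in inner-product form on a window** `(a, b]`: for `f, g ∈ L²(a, b]`,
`Σ_n conj(f̂ₙ) ĝₙ = (b − a)⁻¹ ∫_a^b conj(f) g`, where `f̂ₙ = fourierCoeffOn` are the Fourier
coefficients of period `b − a` (Mathlib's Hilbert basis `fourierBasis`); the "mean-square
convergence of complex Fourier series" step of Brown's proof used by Platt.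
[cite: Platt2016GRH, Theorem 8.1 p. 3020 (proof step; Brown 1967 p. 79)] -/
theorem hasSum_conj_fourierCoeffOn_mul_fourierCoeffOn {a b : ℝ} (hab : a < b) {f g : ℝ → ℂ}
    (hf : MemLp f 2 (volume.restrict (Ioc a b))) (hg : MemLp g 2 (volume.restrict (Ioc a b))) :
    HasSum (fun n : ℤ => conj (fourierCoeffOn hab f n) * fourierCoeffOn hab g n)
      (((b - a)⁻¹ : ℝ) • ∫ x in a..b, conj (f x) * g x) := by
  haveI : Fact (0 < b - a) := ⟨by linarith⟩
  have hf' : MemLp f 2 (volume.restrict (Ioc a (a + (b - a)))) := by rwa [add_sub_cancel]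
  have hg' : MemLp g 2 (volume.restrict (Ioc a (a + (b - a)))) := by rwa [add_sub_cancel]
  have hF := hf'.memLp_liftIoc.haarAddCircle
  have hG := hg'.memLp_liftIoc.haarAddCircle
  have key := fourierBasis.hasSum_inner_mul_inner hF.toLp hG.toLp
  have coefG : ∀ i : ℤ, inner ℂ (fourierBasis i) hG.toLp = fourierCoeffOn hab g i := by
    intro i
    rw [← fourierBasis.repr_apply_apply, fourierBasis_repr, fourierCoeff_congr_ae hG.coeFn_toLp,
      fourierCoeff_liftIoc_eq]
    simp [add_sub_cancel]
  have coefF : ∀ i : ℤ, inner ℂ (fourierBasis i) hF.toLp = fourierCoeffOn hab f i := by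
    intro i
    rw [← fourierBasis.repr_apply_apply, fourierBasis_repr, fourierCoeff_congr_ae hF.coeFn_toLp,
      fourierCoeff_liftIoc_eq]
    simp [add_sub_cancel]
  have h1 : (fun i : ℤ => inner ℂ hF.toLp (fourierBasis i) * inner ℂ (fourierBasis i) hG.toLp)
      = fun n : ℤ => conj (fourierCoeffOn hab f n) * fourierCoeffOn hab g n := by
    funext i
    rw [← inner_conj_symm, coefF, coefG]
  have h2 : inner ℂ hF.toLp hG.toLp = ((b - a)⁻¹ : ℝ) • ∫ x in a..b, conj (f x) * g x := by
    rw [MeasureTheory.L2.inner_def]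
    simp_rw [RCLike.inner_apply']
    set F : Lp ℂ 2 (haarAddCircle (T := b - a)) := hF.toLp with hFdef
    set G : Lp ℂ 2 (haarAddCircle (T := b - a)) := hG.toLp with hGdef
    have : (fun t : AddCircle (b - a) => conj (F t) * G t)
        =ᵐ[haarAddCircle] fun t => liftIoc (b - a) a (fun x => conj (f x) * g x) t := by
      filter_upwards [hF.coeFn_toLp, hG.coeFn_toLp] with t h1 h2
      rw [hFdef, hGdef, h1, h2]
      simp [AddCircle.liftIoc]
    rw [integral_congr_ae this, AddCircle.integral_haarAddCircle,
      AddCircle.integral_liftIoc_eq_intervalIntegral, add_sub_cancel]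
  rw [h1, h2] at key
  exact key


/-- `∫_{-T/2}^{T/2} e^{2πi s ξ} dξ = sin(π T s)/(π s)` for `s ≠ 0`. [folklore] -/
private theorem integral_cexp_symm_window {T s : ℝ} (hs : s ≠ 0) :
    ∫ ξ in -(T / 2)..(T / 2), cexp (2 * π * I * s * ξ) = (Real.sin (π * T * s) / (π * s) : ℝ) := by
  have hc : (2 * π * I * s : ℂ) ≠ 0 := by
    simp [Real.pi_ne_zero, hs, Complex.I_ne_zero]
  rw [integral_exp_mul_complex hc]
  have h1 : (2 * π * I * s : ℂ) * (T / 2 : ℝ) = ((π * T * s : ℝ) : ℂ) * I := by push_cast; ring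
  have h2 : (2 * π * I * s : ℂ) * (-(T / 2) : ℝ) = (-((π * T * s : ℝ) : ℂ)) * I := by
    push_cast; ring
  rw [h1, h2, Complex.exp_mul_I, Complex.exp_mul_I, Complex.cos_neg, Complex.sin_neg]
  rw [div_eq_iff hc]
  push_cast
  have hπ : (π : ℂ) ≠ 0 := by exact_mod_cast Real.pi_ne_zero
  have hs' : (s : ℂ) ≠ 0 := by exact_mod_cast hs
  field_simp
  ring_nf

/-- `∫_{-T/2}^{T/2} e^{2π i s ξ} dξ = T · sinc(π T s)` for every real `s`. [folklore] -/
private theorem integral_cexp_symm_window_eq_sinc {T : ℝ} (hT : 0 < T) (s : ℝ) :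
    ∫ ξ in -(T / 2)..(T / 2), cexp (2 * π * I * s * ξ) = (T * Real.sinc (π * T * s) : ℝ) := by
  rcases eq_or_ne s 0 with rfl | hs
  · simp
  · rw [integral_cexp_symm_window hs, Real.sinc_of_ne_zero (by positivity)]
    congr 1
    field_simp

/-- Fourier coefficients of the exponential kernel on the symmetric window:
`(1/T) ∫_{-T/2}^{T/2} e^{-2πi n ξ/T} e^{-2πi t ξ} dξ = sinc(π(Tt + n))`.
[cite: Platt2016GRH, Theorem 8.1 p. 3020 (proof step)] -/
theorem fourierCoeffOn_cexp_neg {T : ℝ} (hT : 0 < T) (t : ℝ) (n : ℤ) :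
    fourierCoeffOn (show -(T / 2) < T / 2 by linarith) (fun ξ : ℝ => cexp (-(2 * π * I * t * ξ))) n
      = (Real.sinc (π * (T * t + n)) : ℂ) := by
  rw [fourierCoeffOn_eq_integral]
  have hTT : T / 2 - -(T / 2) = T := by ring
  have : (fun ξ : ℝ =>
        (fourier (-n)) (ξ : AddCircle (T / 2 - -(T / 2))) • cexp (-(2 * π * I * t * ξ)))
      = fun ξ : ℝ => cexp (2 * π * I * ((-(t + n / T) : ℝ) : ℂ) * ξ) := by
    funext ξ
    rw [fourier_coe_apply, smul_eq_mul, ← Complex.exp_add, hTT]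
    congr 1
    push_cast
    field_simp
    ring
  have hs : Real.sinc (π * T * (-(t + n / T))) = Real.sinc (π * (T * t + n)) := by
    rw [← Real.sinc_neg]
    congr 1
    field_simp
  rw [this, integral_cexp_symm_window_eq_sinc hT, hs, hTT, Complex.real_smul]
  have hT' : (T : ℂ) ≠ 0 := by exact_mod_cast hT.ne'
  push_cast
  field_simp


/-- Unimodular exponentials are square-integrable on a window. [folklore] -/
private theorem memLp_two_cexp_neg (t a b : ℝ) :
    MemLp (fun ξ : ℝ => cexp (-(2 * π * I * t * ξ))) 2 (volume.restrict (Ioc a b)) := by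
  refine (memLp_top_of_bound (C := 1) (by fun_prop) ?_).mono_exponent le_top
  refine Filter.Eventually.of_forall fun ξ => ?_
  rw [show -(2 * π * I * t * ξ : ℂ) = ((-(2 * π * t * ξ) : ℝ) : ℂ) * I by push_cast; ring,
    Complex.norm_exp_ofReal_mul_I]

/-- `conj e^{−2πitξ} = e^{2πitξ}` for real `t, ξ`. [folklore] -/
private theorem conj_cexp_neg (t ξ : ℝ) :
    conj (cexp (-(2 * π * I * t * ξ))) = cexp (2 * π * I * t * ξ) := by
  rw [← Complex.exp_conj]
  congr 1
  simp only [map_neg, map_mul, Complex.conj_I, Complex.conj_ofReal, map_ofNat]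
  ring

/-- **Core sampling identity for a window-limited spectrum.** For `P ∈ L²(−T/2, T/2]` and
`g(t) = ∫_{−T/2}^{T/2} e^{2πitξ} P(ξ) dξ`: `Σ_{n ∈ ℤ} sinc(π(Tt − n)) g(n/T) = g(t)`, the series
converging unconditionally (Parseval pairing of `P` with the kernel `e^{2πitξ}`, whose coefficients
are the sinc values). [cite: Platt2016GRH, Theorem 8.1 p. 3020 (proof mechanism)] -/
theorem hasSum_sinc_mul_windowIntegral {T : ℝ} (hT : 0 < T) {P : ℝ → ℂ}
    (hP : MemLp P 2 (volume.restrict (Ioc (-(T / 2)) (T / 2)))) (t : ℝ) :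
    HasSum (fun n : ℤ => (Real.sinc (π * (T * t - n)) : ℂ) *
        ∫ ξ in -(T / 2)..(T / 2), cexp (2 * π * I * (n / T) * ξ) * P ξ)
      (∫ ξ in -(T / 2)..(T / 2), cexp (2 * π * I * t * ξ) * P ξ) := by
  have hab : -(T / 2) < T / 2 := by linarith
  have hTT : T / 2 - -(T / 2) = T := by ring
  have hT' : (T : ℂ) ≠ 0 := by exact_mod_cast hT.ne'
  set S : ℤ → ℂ := fun n : ℤ => (Real.sinc (π * (T * t - n)) : ℂ) *
        ∫ ξ in -(T / 2)..(T / 2), cexp (2 * π * I * (n / T) * ξ) * P ξ with hS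
  set V : ℂ := ∫ ξ in -(T / 2)..(T / 2), cexp (2 * π * I * t * ξ) * P ξ with hV
  have key := hasSum_conj_fourierCoeffOn_mul_fourierCoeffOn hab (memLp_two_cexp_neg t _ _) hP
  have hterm : ∀ n : ℤ,
      conj (fourierCoeffOn hab (fun ξ : ℝ => cexp (-(2 * π * I * t * ξ))) n) *
          fourierCoeffOn hab P n
        = (T : ℂ)⁻¹ * S (-n) := by
    intro n
    rw [fourierCoeffOn_cexp_neg hT t, Complex.conj_ofReal, fourierCoeffOn_eq_integral, hS]
    simp only [Int.cast_neg, sub_neg_eq_add, Complex.real_smul, hTT]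
    have : (∫ x in -(T / 2)..(T / 2), (fourier (-n)) (x : AddCircle (T / 2 - -(T / 2))) • P x)
        = ∫ ξ in -(T / 2)..(T / 2), cexp (2 * π * I * ((-(n : ℝ) : ℝ) / T) * ξ) * P ξ := by
      apply intervalIntegral.integral_congr
      intro ξ _
      simp only [fourier_coe_apply, smul_eq_mul, hTT]
      congr 1
      push_cast
      ring_nf
    rw [this]
    push_cast
    ring
  have hval : (((T / 2 - -(T / 2))⁻¹ : ℝ) •
      ∫ ξ in -(T / 2)..(T / 2), conj (cexp (-(2 * π * I * t * ξ))) * P ξ) = (T : ℂ)⁻¹ * V := by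
    simp_rw [conj_cexp_neg, hTT, Complex.real_smul, hV]
    push_cast
    ring
  simp_rw [hterm, hval] at key
  have key2 := key.mul_left (T : ℂ)
  simp_rw [← mul_assoc, mul_inv_cancel₀ hT', one_mul] at key2
  have key3 : HasSum (S ∘ (Equiv.neg ℤ)) V := key2
  exact (Equiv.neg ℤ).hasSum_iff.mp key3

/-- The inverse Fourier integral of a function vanishing off `[-T/2, T/2]` is the window
integral. [folklore] -/
private theorem fourierInv_eq_windowIntegral {F : ℝ → ℂ} {T : ℝ}
    (hF : ∀ ξ, ξ ∉ Icc (-(T / 2)) (T / 2) → F ξ = 0) (hT : 0 < T) (t : ℝ) :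
    𝓕⁻ F t = ∫ ξ in -(T / 2)..(T / 2), cexp (2 * π * I * t * ξ) * F ξ := by
  rw [Real.fourierInv_eq']
  simp only [RCLike.inner_apply', conj_trivial, smul_eq_mul]
  rw [intervalIntegral.integral_of_le (by linarith), ← integral_Icc_eq_integral_Ioc,
    ← setIntegral_eq_integral_of_forall_compl_eq_zero (s := Icc (-(T / 2)) (T / 2))]
  · apply setIntegral_congr_fun measurableSet_Icc
    intro ξ _
    push_cast
    ring_nf
  · intro ξ hξ
    simp [hF ξ hξ]

/-- The band-limited set-up of Theorem 8.1: `𝓕 f` is square-integrable on the window and `f` is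
the window integral of `𝓕 f` (Fourier inversion). [folklore] -/
private theorem bandLimited_aux {f : ℝ → ℂ} {T : ℝ} (hT : 0 < T) (hf : Continuous f)
    (hfi : Integrable f) (hband : ∀ ξ : ℝ, T / 2 < |ξ| → 𝓕 f ξ = 0) :
    MemLp (𝓕 f) 2 (volume.restrict (Ioc (-(T / 2)) (T / 2))) ∧
      ∀ s : ℝ, f s = ∫ ξ in -(T / 2)..(T / 2), cexp (2 * π * I * s * ξ) * 𝓕 f ξ := by
  have hFc : Continuous (𝓕 f) :=
    VectorFourier.fourierIntegral_continuous Real.continuous_fourierChar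
      (innerSL ℝ).continuous₂ hfi
  have hF0 : ∀ ξ, ξ ∉ Icc (-(T / 2)) (T / 2) → 𝓕 f ξ = 0 := by
    intro ξ hξ
    apply hband
    simp only [mem_Icc, not_and_or, not_le] at hξ
    rcases hξ with h | h
    · rw [abs_of_neg (by linarith)]; linarith
    · rw [abs_of_pos (by linarith)]; linarith
  have hFsupp : HasCompactSupport (𝓕 f) := HasCompactSupport.intro isCompact_Icc hF0
  have hFi : Integrable (𝓕 f) := hFc.integrable_of_hasCompactSupport hFsupp
  obtain ⟨C, hC⟩ := hFc.bounded_above_of_compact_support hFsupp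
  refine ⟨(memLp_top_of_bound (C := C) hFc.aestronglyMeasurable
      (Filter.Eventually.of_forall hC)).mono_exponent le_top, fun s => ?_⟩
  rw [← fourierInv_eq_windowIntegral hF0 hT s, hf.fourierInv_fourier_eq hfi hFi]

/-- **Whittaker–Shannon sampling theorem** (Platt 2016, Theorem 8.1), over Mathlib's Fourier
transform `𝓕 f (ξ) = ∫ f(t) e^{-2πiξt} dt`: a continuous integrable `f : ℝ → ℂ` whose Fourier
transform vanishes for `|ξ| > T/2` (`T > 0`) is recovered from its samples at spacing `1/T`:
`f(t) = Σ_{n ∈ ℤ} f(n/T) · sinc(π(Tt − n))`, the series converging (unconditionally).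
In Platt's letters `A = T`: "`f(t) = Σ f(n/A) sinc(nπ − πAt)` when this sum converges", for
`f̂` supported in `|x| ≤ A/2` — here convergence is part of the conclusion.
[cite: Platt2016GRH, Theorem 8.1 p. 3020 (journal; = arXiv:1305.3087 Thm. 6.1)] -/
theorem _root_.Literature.NumberTheory.LFunctions.whittakerShannon_hasSum {f : ℝ → ℂ} {T : ℝ}
    (hT : 0 < T) (hf : Continuous f) (hfi : Integrable f)
    (hband : ∀ ξ : ℝ, T / 2 < |ξ| → 𝓕 f ξ = 0) (t : ℝ) :
    HasSum (fun n : ℤ => f (n / T) * Real.sinc (π * (T * t - n))) (f t) := by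
  obtain ⟨hFL2, hinv⟩ := bandLimited_aux hT hf hfi hband
  have key := hasSum_sinc_mul_windowIntegral hT hFL2 t
  rw [← hinv t] at key
  have e : (fun n : ℤ => (Real.sinc (π * (T * t - n)) : ℂ) *
        ∫ ξ in -(T / 2)..(T / 2), cexp (2 * π * I * (n / T) * ξ) * 𝓕 f ξ)
      = fun n : ℤ => f (n / T) * Real.sinc (π * (T * t - n)) := by
    funext n
    rw [hinv ((n : ℝ) / T), mul_comm]
    push_cast
    ring_nf
  rwa [e] at key

/-! ## Periodisation of the spectrum and the aliasing error (Platt 2016, Theorem 8.2) -/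

/-- Cutting `ℝ` into the period cells `(a + kT, a + (k+1)T]`: for an integrable `G`,
`∫_ℝ G = Σ_{k ∈ ℤ} ∫_a^{a+T} G(ξ + kT) dξ` (the cell decomposition behind aliasing).
[cite: Platt2016GRH, Theorem 8.2 p. 3021 (proof step; Brown 1967 Lemma 1)] -/
theorem hasSum_intervalIntegral_comp_add_zsmul {E : Type*} [NormedAddCommGroup E]
    [NormedSpace ℝ E] [CompleteSpace E] {G : ℝ → E} (hG : Integrable G) {T : ℝ} (hT : 0 < T)
    (a : ℝ) : HasSum (fun k : ℤ => ∫ ξ in a..a + T, G (ξ + k * T)) (∫ ξ, G ξ) := by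
  have hunion := iUnion_Ioc_add_zsmul hT a
  have hdisj := pairwise_disjoint_Ioc_add_zsmul a T
  have h := hasSum_integral_iUnion (μ := volume) (f := G)
    (fun k : ℤ => (measurableSet_Ioc : MeasurableSet (Ioc (a + k • T) (a + (k + 1) • T)))) hdisj
    (by rw [hunion]; exact hG.integrableOn)
  rw [hunion, Measure.restrict_univ] at h
  have e : (fun k : ℤ => ∫ ξ in Ioc (a + k • T) (a + (k + 1) • T), G ξ)
      = fun k : ℤ => ∫ ξ in a..a + T, G (ξ + k * T) := by
    funext k
    rw [intervalIntegral.integral_comp_add_right, intervalIntegral.integral_of_le]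
    · simp only [zsmul_eq_mul]
      congr 3; push_cast; ring
    · linarith
  rwa [e] at h

/-- Under summable sup-bounds on the cells, the periodisation converges absolutely on the
window. [folklore] -/
private theorem summable_translates {F : ℝ → ℂ} {T : ℝ} {M : ℤ → ℝ} (hM : Summable M)
    (hbd : ∀ (k : ℤ) (ξ : ℝ), ξ ∈ Ioc (-(T / 2)) (T / 2) → ‖F (ξ + k * T)‖ ≤ M k)
    {ξ : ℝ} (hξ : ξ ∈ Ioc (-(T / 2)) (T / 2)) : Summable (fun k : ℤ => F (ξ + k * T)) :=
  Summable.of_norm_bounded hM (fun k => hbd k ξ hξ)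

/-- `‖P_T F(ξ)‖ ≤ Σ_k M_k` on the window. [cite: Platt2016GRH, Theorem 8.2 p. 3021 (proof step)] -/
theorem norm_periodization_le {F : ℝ → ℂ} {T : ℝ} {M : ℤ → ℝ} (hM : Summable M)
    (hbd : ∀ (k : ℤ) (ξ : ℝ), ξ ∈ Ioc (-(T / 2)) (T / 2) → ‖F (ξ + k * T)‖ ≤ M k)
    {ξ : ℝ} (hξ : ξ ∈ Ioc (-(T / 2)) (T / 2)) : ‖∑' k : ℤ, F (ξ + k * T)‖ ≤ ∑' k, M k :=
  tsum_of_norm_bounded hM.hasSum (fun k => hbd k ξ hξ)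

/-- Translates of an a.e.-strongly-measurable function are a.e.-strongly measurable. [folklore] -/
private theorem aestronglyMeasurable_comp_add {F : ℝ → ℂ} (hF : AEStronglyMeasurable F volume)
    (c : ℝ) :
    AEStronglyMeasurable (fun ξ : ℝ => F (ξ + c)) volume :=
  hF.comp_measurePreserving (measurePreserving_add_right volume c)

/-- The periodisation is square-integrable on the window (indeed bounded), under summable cell
bounds. [cite: Platt2016GRH, Theorem 8.2 p. 3021 (proof step)] -/
theorem memLp_periodization {F : ℝ → ℂ} (hF : AEStronglyMeasurable F volume) {T : ℝ}
    {M : ℤ → ℝ} (hM : Summable M)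
    (hbd : ∀ (k : ℤ) (ξ : ℝ), ξ ∈ Ioc (-(T / 2)) (T / 2) → ‖F (ξ + k * T)‖ ≤ M k) :
    MemLp (fun ξ : ℝ => ∑' k : ℤ, F (ξ + k * T)) 2 (volume.restrict (Ioc (-(T / 2)) (T / 2))) := by
  have hmeas : AEStronglyMeasurable (fun ξ : ℝ => ∑' k : ℤ, F (ξ + k * T))
      (volume.restrict (Ioc (-(T / 2)) (T / 2))) := by
    apply AEMeasurable.aestronglyMeasurable
    apply AEMeasurable.tsum
    intro k
    exact ((aestronglyMeasurable_comp_add hF (k * T)).restrict).aemeasurable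
  refine (memLp_top_of_bound (C := ∑' k, M k) hmeas ?_).mono_exponent le_top
  filter_upwards [ae_restrict_mem measurableSet_Ioc] with ξ hξ
  exact norm_periodization_le hM hbd hξ

/-- `𝓕⁻ F (s) = ∫ e^{2πi s v} F(v) dv` (Mathlib's inverse Fourier integral on `ℝ`, unfolded).
[folklore] -/
private theorem fourierInv_eq_integral_cexp (F : ℝ → ℂ) (s : ℝ) :
    𝓕⁻ F s = ∫ v : ℝ, cexp (2 * π * I * s * v) * F v := by
  rw [Real.fourierInv_eq']
  congr 1
  funext v
  simp only [RCLike.inner_apply', conj_trivial, smul_eq_mul]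
  push_cast
  ring_nf

/-- `e^{2πi (n/T)(ξ + kT)} = e^{2πi (n/T) ξ}`: the sampling exponentials are `T`-periodic.
[folklore] -/
private theorem cexp_sample_translate (n k : ℤ) {T : ℝ} (hT : T ≠ 0) (ξ : ℝ) :
    cexp (2 * π * I * ((n : ℝ) / T : ℝ) * (ξ + k * T : ℝ)) =
      cexp (2 * π * I * ((n : ℝ) / T : ℝ) * ξ) := by
  have : (2 * π * I * ((n : ℝ) / T : ℝ) * (ξ + k * T : ℝ) : ℂ)
      = 2 * π * I * ((n : ℝ) / T : ℝ) * ξ + ((n * k : ℤ) : ℂ) * (2 * π * I) := by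
    have hT' : (T : ℂ) ≠ 0 := by exact_mod_cast hT
    push_cast
    field_simp
  rw [this, Complex.exp_add, Complex.exp_int_mul_two_pi_mul_I, mul_one]

/-- Unimodularity: `‖e^{2πi s v}‖ = 1`. [folklore] -/
private theorem norm_cexp_two_pi_mul_I (s v : ℝ) : ‖cexp (2 * π * I * s * v)‖ = 1 := by
  rw [show (2 * π * I * s * v : ℂ) = ((2 * π * s * v : ℝ) : ℂ) * I by push_cast; ring,
    Complex.norm_exp_ofReal_mul_I]

/-- A translate of an integrable `F` times a sampling exponential is integrable on the window.
[folklore] -/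
private theorem integrableOn_cexp_mul_translate {F : ℝ → ℂ} (hFi : Integrable F) (s c : ℝ)
    (S : Set ℝ) :
    Integrable (fun ξ : ℝ => cexp (2 * π * I * s * ξ) * F (ξ + c)) (volume.restrict S) := by
  refine Integrable.bdd_mul (c := 1) ((hFi.comp_add_right c).restrict) (by fun_prop) ?_
  exact Filter.Eventually.of_forall fun ξ => (norm_cexp_two_pi_mul_I s ξ).le

/-- `Σ_k ∫_{-T/2}^{T/2} ‖F(ξ + kT)‖ dξ = ∫_ℝ ‖F‖`. [folklore] -/
private theorem hasSum_windowIntegral_norm_translate {F : ℝ → ℂ} (hFi : Integrable F) {T : ℝ}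
    (hT : 0 < T) :
    HasSum (fun k : ℤ => ∫ ξ in Ioc (-(T / 2)) (T / 2), ‖F (ξ + k * T)‖) (∫ ξ, ‖F ξ‖) := by
  have h := hasSum_intervalIntegral_comp_add_zsmul hFi.norm hT (-(T / 2))
  rw [show -(T / 2) + T = T / 2 by ring] at h
  simp_rw [intervalIntegral.integral_of_le (show -(T / 2) ≤ T / 2 by linarith)] at h
  exact h

/-- **Samples see only the periodised spectrum**: `𝓕⁻ F (n/T) = ∫_{-T/2}^{T/2} e^{2πi (n/T) ξ}
P_T F(ξ) dξ` for every integrable `F` (Poisson-summation mechanism behind aliasing).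
[cite: Platt2016GRH, Theorem 8.2 p. 3021 (proof step; Brown 1967 Lemma 1)] -/
theorem fourierInv_sample_eq_windowIntegral_periodization {F : ℝ → ℂ} (hFi : Integrable F)
    {T : ℝ} (hT : 0 < T) (n : ℤ) :
    𝓕⁻ F (n / T) = ∫ ξ in -(T / 2)..(T / 2),
      cexp (2 * π * I * ((n : ℝ) / T : ℝ) * ξ) * (∑' k : ℤ, F (ξ + k * T)) := by
  have hT0 : T ≠ 0 := hT.ne'
  have hle : -(T / 2) ≤ T / 2 := by linarith
  have hG : Integrable (fun v : ℝ => cexp (2 * π * I * ((n : ℝ) / T : ℝ) * v) * F v) := by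
    have h := integrableOn_cexp_mul_translate hFi ((n : ℝ) / T) 0 univ
    rw [Measure.restrict_univ] at h
    simpa only [add_zero] using h
  have h1 := hasSum_intervalIntegral_comp_add_zsmul hG hT (-(T / 2))
  rw [show -(T / 2) + T = T / 2 by ring] at h1
  simp_rw [cexp_sample_translate n _ hT0] at h1
  rw [fourierInv_eq_integral_cexp, ← h1.tsum_eq]
  simp_rw [← tsum_mul_left, intervalIntegral.integral_of_le hle]
  refine integral_tsum_of_summable_integral_norm
    (fun k => integrableOn_cexp_mul_translate hFi _ _ _) ?_
  refine (hasSum_windowIntegral_norm_translate hFi hT).summable.congr fun k => ?_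
  simp_rw [norm_mul, norm_cexp_two_pi_mul_I, one_mul]

/-- **The window integral of the periodised spectrum is summed by the sampling series**:
under summable sup-bounds `‖F(ξ + kT)‖ ≤ M_k` on the window (so that `P_T F` is bounded),
`Σ_n 𝓕⁻F(n/T) sinc(π(Tt − n)) = ∫_{-T/2}^{T/2} e^{2πi t ξ} P_T F(ξ) dξ`.
[cite: Platt2016GRH, Theorem 8.2 p. 3021 (proof step)] -/
theorem hasSum_fourierInv_sample_mul_sinc {F : ℝ → ℂ} (hFi : Integrable F) {T : ℝ} (hT : 0 < T)
    {M : ℤ → ℝ} (hM : Summable M)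
    (hbd : ∀ (k : ℤ) (ξ : ℝ), ξ ∈ Ioc (-(T / 2)) (T / 2) → ‖F (ξ + k * T)‖ ≤ M k) (t : ℝ) :
    HasSum (fun n : ℤ => 𝓕⁻ F (n / T) * Real.sinc (π * (T * t - n)))
      (∫ ξ in -(T / 2)..(T / 2), cexp (2 * π * I * t * ξ) * (∑' k : ℤ, F (ξ + k * T))) := by
  have key := hasSum_sinc_mul_windowIntegral hT (memLp_periodization hFi.1 hM hbd) t
  have e : (fun n : ℤ => (Real.sinc (π * (T * t - n)) : ℂ) *
        ∫ ξ in -(T / 2)..(T / 2), cexp (2 * π * I * (n / T) * ξ) * (∑' k : ℤ, F (ξ + k * T)))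
      = fun n : ℤ => 𝓕⁻ F (n / T) * Real.sinc (π * (T * t - n)) := by
    funext n
    rw [fourierInv_sample_eq_windowIntegral_periodization hFi hT n, mul_comm]
    congr 1
    refine intervalIntegral.integral_congr fun ξ _ => ?_
    push_cast
    ring_nf
  rwa [e] at key

/-- **The aliasing error** (the mechanism of Weiss's theorem, for any integrable spectrum):
`‖𝓕⁻F(t) − ∫_{-T/2}^{T/2} e^{2πi t ξ} P_T F(ξ) dξ‖ ≤ 2 ∫_{|ξ| ∉ (-T/2, T/2]} ‖F(ξ)‖ dξ`.
[cite: Platt2016GRH, Theorem 8.2 p. 3021 (proof: "see [5]" = Brown 1967)] -/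
theorem norm_fourierInv_sub_windowIntegral_periodization_le {F : ℝ → ℂ} (hFi : Integrable F)
    {T : ℝ} (hT : 0 < T) (t : ℝ) :
    ‖𝓕⁻ F t - ∫ ξ in -(T / 2)..(T / 2), cexp (2 * π * I * t * ξ) * (∑' k : ℤ, F (ξ + k * T))‖
      ≤ 2 * ∫ ξ in (Ioc (-(T / 2)) (T / 2))ᶜ, ‖F ξ‖ := by
  have hle : -(T / 2) ≤ T / 2 := by linarith
  -- (a) the cells of `𝓕⁻ F t`
  have hG : Integrable (fun v : ℝ => cexp (2 * π * I * t * v) * F v) := by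
    have h := integrableOn_cexp_mul_translate hFi t 0 univ
    rw [Measure.restrict_univ] at h
    simpa only [add_zero] using h
  have ha := hasSum_intervalIntegral_comp_add_zsmul hG hT (-(T / 2))
  rw [show -(T / 2) + T = T / 2 by ring, ← fourierInv_eq_integral_cexp] at ha
  simp_rw [intervalIntegral.integral_of_le hle] at ha
  -- (b) the cells of the window integral of the periodisation
  have hb : HasSum (fun k : ℤ => ∫ ξ in Ioc (-(T / 2)) (T / 2),
      cexp (2 * π * I * t * ξ) * F (ξ + k * T))
      (∫ ξ in -(T / 2)..(T / 2), cexp (2 * π * I * t * ξ) * (∑' k : ℤ, F (ξ + k * T))) := by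
    rw [intervalIntegral.integral_of_le hle]
    simp_rw [← tsum_mul_left]
    refine hasSum_integral_of_summable_integral_norm
      (fun k => integrableOn_cexp_mul_translate hFi _ _ _) ?_
    refine (hasSum_windowIntegral_norm_translate hFi hT).summable.congr fun k => ?_
    simp_rw [norm_mul, norm_cexp_two_pi_mul_I, one_mul]
  -- (c) the difference, cell by cell; the cell `k = 0` contributes nothing
  have hN := hasSum_windowIntegral_norm_translate hFi hT
  rw [← (ha.sub hb).tsum_eq]
  have hg : HasSum (fun k : ℤ => 2 * (∫ ξ in Ioc (-(T / 2)) (T / 2), ‖F (ξ + k * T)‖) -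
      2 * (if k = 0 then (∫ ξ in Ioc (-(T / 2)) (T / 2), ‖F (ξ + (0 : ℤ) * T)‖) else 0))
      (2 * (∫ ξ, ‖F ξ‖) - 2 * (∫ ξ in Ioc (-(T / 2)) (T / 2), ‖F (ξ + (0 : ℤ) * T)‖)) :=
    (hN.mul_left 2).sub ((hasSum_ite_eq (0 : ℤ) _).mul_left 2)
  have hcompl : 2 * (∫ ξ, ‖F ξ‖) - 2 * (∫ ξ in Ioc (-(T / 2)) (T / 2), ‖F (ξ + (0 : ℤ) * T)‖)
      = 2 * ∫ ξ in (Ioc (-(T / 2)) (T / 2))ᶜ, ‖F ξ‖ := by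
    have := integral_add_compl (μ := volume) (measurableSet_Ioc (a := -(T / 2)) (b := T / 2))
      hFi.norm
    simp only [Int.cast_zero, zero_mul, add_zero]
    linarith
  rw [← hcompl]
  refine tsum_of_norm_bounded hg fun k => ?_
  by_cases hk : k = 0
  · subst hk
    simp
  · simp only [hk, if_false, mul_zero, sub_zero]
    have hA : Integrable (fun ξ : ℝ => cexp (2 * π * I * t * (ξ + k * T : ℝ)) * F (ξ + k * T))
        (volume.restrict (Ioc (-(T / 2)) (T / 2))) := (hG.comp_add_right (k * T)).restrict
    have hB := integrableOn_cexp_mul_translate hFi t (k * T) (Ioc (-(T / 2)) (T / 2))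
    have hF2 : Integrable (fun ξ : ℝ => 2 * ‖F (ξ + k * T)‖)
        (volume.restrict (Ioc (-(T / 2)) (T / 2))) :=
      ((hFi.comp_add_right (k * T)).restrict).norm.const_mul 2
    rw [← integral_sub hA hB, ← MeasureTheory.integral_const_mul]
    refine (MeasureTheory.norm_integral_le_integral_norm _).trans ?_
    refine integral_mono_of_nonneg (Filter.Eventually.of_forall fun _ => norm_nonneg _) hF2
      (Filter.Eventually.of_forall fun ξ => ?_)
    dsimp only
    rw [← sub_mul, norm_mul]
    refine mul_le_mul_of_nonneg_right ?_ (norm_nonneg _)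
    refine (norm_sub_le _ _).trans ?_
    rw [norm_cexp_two_pi_mul_I, norm_cexp_two_pi_mul_I]
    norm_num

/-- **Weiss's aliasing bound, general form** (Platt 2016, Theorem 8.2, hypotheses replaced by what
its proof uses): if the spectrum `F ∈ L¹(ℝ)` admits summable sup-bounds `‖F(ξ + kT)‖ ≤ M_k`
over the period cells, then the cardinal series of `f = 𝓕⁻ F` at spacing `1/T` converges and
`‖f(t) − Σ_n f(n/T) sinc(π(Tt − n))‖ ≤ 2 ∫_{ξ ∉ (−T/2, T/2]} ‖F(ξ)‖ dξ`.
[cite: Platt2016GRH, Theorem 8.2 p. 3021] -/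
theorem norm_fourierInv_sub_tsum_sample_mul_sinc_le {F : ℝ → ℂ} (hFi : Integrable F) {T : ℝ}
    (hT : 0 < T) {M : ℤ → ℝ} (hM : Summable M)
    (hbd : ∀ (k : ℤ) (ξ : ℝ), ξ ∈ Ioc (-(T / 2)) (T / 2) → ‖F (ξ + k * T)‖ ≤ M k) (t : ℝ) :
    ‖𝓕⁻ F t - ∑' n : ℤ, 𝓕⁻ F (n / T) * Real.sinc (π * (T * t - n))‖
      ≤ 2 * ∫ ξ in (Ioc (-(T / 2)) (T / 2))ᶜ, ‖F ξ‖ := by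
  rw [(hasSum_fourierInv_sample_mul_sinc hFi hT hM hbd t).tsum_eq]
  exact norm_fourierInv_sub_windowIntegral_periodization_le hFi hT t

/-! ### Bounded variation (Weiss's hypothesis (2)) gives the summable cell bounds -/

/-- Super-additivity of the variation over the ordered cells `[−T/2 + kT, T/2 + kT]`:
a finite sum of cell variations is at most the total variation. [folklore] -/
private theorem sum_eVariationOn_cells_le (F : ℝ → ℂ) {T : ℝ} (hT : 0 < T) (s : Finset ℤ) :
    ∑ k ∈ s, eVariationOn F (Icc (-(T / 2) + k * T) (T / 2 + k * T)) ≤ eVariationOn F univ := by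
  classical
  suffices h : ∑ k ∈ s, eVariationOn F (Icc (-(T / 2) + k * T) (T / 2 + k * T))
      ≤ eVariationOn F (⋃ k ∈ s, Icc (-(T / 2) + k * T) (T / 2 + k * T)) from
    h.trans (eVariationOn.mono F (subset_univ _))
  induction s using Finset.induction_on_max with
  | empty => simp
  | insert m s hm ih =>
    rw [Finset.sum_insert (fun h => lt_irrefl m (hm m h)), Finset.set_biUnion_insert, add_comm,
      Set.union_comm]
    refine (add_le_add_left ih _).trans ?_
    refine (eVariationOn.add_le_union F ?_)
    intro x hx y hy
    simp only [mem_iUnion, mem_Icc, exists_prop] at hx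
    obtain ⟨k, hk, -, hxk⟩ := hx
    have hkm : (k : ℝ) + 1 ≤ m := by exact_mod_cast hm k hk
    have : T / 2 + k * T ≤ -(T / 2) + m * T := by nlinarith
    exact hxk.trans (this.trans hy.1)

/-- From `F ∈ L¹(ℝ)` of bounded variation on `ℝ` (Weiss's hypotheses (1)–(2) in Platt's
Theorem 8.2), the cells carry summable sup-bounds: `‖F(ξ + kT)‖ ≤ M_k` on `(−T/2, T/2]` with
`M_k = T⁻¹ ∫_{cell k} ‖F‖ + Var(F; cell k)` and `Σ M_k ≤ T⁻¹‖F‖₁ + Var(F; ℝ)`.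
[cite: Platt2016GRH, Theorem 8.2 p. 3021 (hypotheses (1)–(2))] -/
theorem exists_summable_cell_bound_of_boundedVariationOn {F : ℝ → ℂ} (hFi : Integrable F)
    (hBV : BoundedVariationOn F univ) {T : ℝ} (hT : 0 < T) :
    ∃ M : ℤ → ℝ, Summable M ∧
      ∀ (k : ℤ) (ξ : ℝ), ξ ∈ Ioc (-(T / 2)) (T / 2) → ‖F (ξ + k * T)‖ ≤ M k := by
  set V : ℤ → ℝ := fun k => (eVariationOn F (Icc (-(T / 2) + k * T) (T / 2 + k * T))).toReal
    with hV
  set N : ℤ → ℝ := fun k => ∫ ξ in Ioc (-(T / 2)) (T / 2), ‖F (ξ + k * T)‖ with hN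
  refine ⟨fun k => T⁻¹ * N k + V k, ?_, ?_⟩
  · -- summability
    refine ((hasSum_windowIntegral_norm_translate hFi hT).summable.mul_left T⁻¹).add ?_
    refine summable_of_sum_le (c := (eVariationOn F univ).toReal) (fun k => ENNReal.toReal_nonneg)
      fun s => ?_
    rw [hV]
    dsimp only
    rw [← ENNReal.toReal_sum (fun (k : ℤ) _ => ((hBV.mono (subset_univ _)) :
      eVariationOn F (Icc (-(T / 2) + (k : ℝ) * T) (T / 2 + (k : ℝ) * T)) ≠ ⊤))]
    exact ENNReal.toReal_mono hBV (sum_eVariationOn_cells_le F hT s)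
  · -- the bound on each cell
    intro k ξ hξ
    have hcell : ξ + k * T ∈ Icc (-(T / 2) + k * T) (T / 2 + k * T) :=
      ⟨by linarith [hξ.1], by linarith [hξ.2]⟩
    have hBVk : BoundedVariationOn F (Icc (-(T / 2) + k * T) (T / 2 + k * T)) :=
      hBV.mono (subset_univ _)
    -- pointwise: `‖F(ξ + kT)‖ ≤ ‖F y‖ + V k` for every `y` in the cell
    have hpt : ∀ y ∈ Icc (-(T / 2) + k * T) (T / 2 + k * T), ‖F (ξ + k * T)‖ ≤ ‖F y‖ + V k := by
      intro y hy
      have hd := hBVk.dist_le hcell hy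
      rw [dist_eq_norm] at hd
      calc ‖F (ξ + k * T)‖ = ‖F y + (F (ξ + k * T) - F y)‖ := by ring_nf
        _ ≤ ‖F y‖ + ‖F (ξ + k * T) - F y‖ := norm_add_le _ _
        _ ≤ ‖F y‖ + V k := by linarith
    -- average over the cell (Lebesgue measure `T`)
    have hle : -(T / 2) + k * T ≤ T / 2 + k * T := by linarith
    have hint : IntegrableOn (fun y => ‖F y‖) (Icc (-(T / 2) + k * T) (T / 2 + k * T)) :=
      hFi.norm.integrableOn
    have hvol : volume (Icc (-(T / 2) + k * T) (T / 2 + k * T)) ≠ ⊤ := by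
      rw [Real.volume_Icc]; exact ENNReal.ofReal_ne_top
    have havg : ∫ y in Icc (-(T / 2) + k * T) (T / 2 + k * T), ‖F (ξ + k * T)‖
        ≤ ∫ y in Icc (-(T / 2) + k * T) (T / 2 + k * T), (‖F y‖ + V k) := by
      refine setIntegral_mono_on (integrableOn_const hvol) (hint.add (integrableOn_const hvol))
        measurableSet_Icc hpt
    rw [setIntegral_const, integral_add hint (integrableOn_const hvol), setIntegral_const,
      Real.volume_real_Icc_of_le hle, smul_eq_mul, smul_eq_mul,
      show T / 2 + k * T - (-(T / 2) + k * T) = T by ring] at havg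
    · -- `∫_{cell k} ‖F‖ = N k`
      have hNk : ∫ y in Icc (-(T / 2) + k * T) (T / 2 + k * T), ‖F y‖ = N k := by
        rw [hN]
        dsimp only
        rw [integral_Icc_eq_integral_Ioc, ← intervalIntegral.integral_of_le hle,
          ← intervalIntegral.integral_of_le (by linarith : -(T / 2) ≤ T / 2),
          ← intervalIntegral.integral_comp_add_right (fun y => ‖F y‖) (k * T)]
      rw [hNk] at havg
      have hT' : T⁻¹ * (T * ‖F (ξ + k * T)‖) = ‖F (ξ + k * T)‖ := by field_simp
      calc ‖F (ξ + k * T)‖ = T⁻¹ * (T * ‖F (ξ + k * T)‖) := hT'.symm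
        _ ≤ T⁻¹ * (N k + T * V k) := by gcongr
        _ = T⁻¹ * N k + V k := by field_simp

/-! ## Platt's Theorem 8.2 for a signal `f` (hypotheses on `f̂ = 𝓕 f`) -/

/-- **Sampling series of `f` under summable cell bounds on `𝓕 f`**: for `f` continuous and
integrable with `𝓕 f ∈ L¹` (so `f = 𝓕⁻ 𝓕 f` pointwise, Mathlib's Fourier inversion) and
`‖𝓕 f(ξ + kT)‖ ≤ M_k` on `(−T/2, T/2]`, `Σ M_k < ∞`, the cardinal series of `f` at spacing `1/T`
converges, to the window integral of the periodised spectrum.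
[cite: Platt2016GRH, Theorem 8.2 p. 3021 (proof step)] -/
theorem hasSum_sample_mul_sinc_of_cell_bound {f : ℝ → ℂ} (hf : Continuous f) (hfi : Integrable f)
    (hFi : Integrable (𝓕 f)) {T : ℝ} (hT : 0 < T) {M : ℤ → ℝ} (hM : Summable M)
    (hbd : ∀ (k : ℤ) (ξ : ℝ), ξ ∈ Ioc (-(T / 2)) (T / 2) → ‖𝓕 f (ξ + k * T)‖ ≤ M k) (t : ℝ) :
    HasSum (fun n : ℤ => f (n / T) * Real.sinc (π * (T * t - n)))
      (∫ ξ in -(T / 2)..(T / 2), cexp (2 * π * I * t * ξ) * (∑' k : ℤ, 𝓕 f (ξ + k * T))) := by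
  have h := hasSum_fourierInv_sample_mul_sinc hFi hT hM hbd t
  rwa [hf.fourierInv_fourier_eq hfi hFi] at h

/-- **Platt 2016 Theorem 8.2, general form**: `‖f(t) − Σ_n f(n/T) sinc(π(Tt − n))‖ ≤
2 ∫_{ξ ∉ (−T/2, T/2]} ‖𝓕 f(ξ)‖ dξ` under summable cell bounds on `𝓕 f` (which is what the
bounded-variation hypothesis of the source delivers, see `platt2016_theorem82`).
[cite: Platt2016GRH, Theorem 8.2 p. 3021] -/
theorem norm_sub_tsum_sample_mul_sinc_le_of_cell_bound {f : ℝ → ℂ} (hf : Continuous f)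
    (hfi : Integrable f) (hFi : Integrable (𝓕 f)) {T : ℝ} (hT : 0 < T) {M : ℤ → ℝ}
    (hM : Summable M)
    (hbd : ∀ (k : ℤ) (ξ : ℝ), ξ ∈ Ioc (-(T / 2)) (T / 2) → ‖𝓕 f (ξ + k * T)‖ ≤ M k) (t : ℝ) :
    ‖f t - ∑' n : ℤ, f (n / T) * Real.sinc (π * (T * t - n))‖
      ≤ 2 * ∫ ξ in (Ioc (-(T / 2)) (T / 2))ᶜ, ‖𝓕 f ξ‖ := by
  have h := norm_fourierInv_sub_tsum_sample_mul_sinc_le hFi hT hM hbd t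
  rwa [hf.fourierInv_fourier_eq hfi hFi] at h

/-- **Platt 2016, Theorem 8.2 (Weiss)** over Mathlib's Fourier transform. Source (p. 3021):
"Let `f(t)` be a real-valued function with Fourier Transform `f̂(x) := (1/2π)∫ f(t) e^{−itx} dt`
such that (1) `∫ |f̂(x)| dx < ∞`, (2) `f̂` is of bounded variation on `ℝ`, (3) when `f̂` has a jump
discontinuity at `x` then `f̂(x)` is the mean of its one-sided limits. Then
`|f(t) − Σ_{n ∈ ℤ} f(n/A) sinc(nπ − πAt)| ≤ 4 ∫_{πA}^∞ |f̂(x)| dx`. Proof. See [5]" (= Brown 1967).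
Typed with `T = A`, for complex-valued `f` (then the right side is `2 ∫_{|ξ| ∉ (−A/2, A/2]} ‖𝓕 f‖`,
which for real `f` is the printed `4 ∫_{A/2}^∞ ‖𝓕 f‖ = 4 ∫_{πA}^∞ |f̂|`, see
`platt2016_theorem82_real` and `Upsampling.plattFourier_eq`), with the source's standing assumptions
made
explicit: `f` continuous and integrable (so `f̂` is defined by the integral and `f = 𝓕⁻ f̂`
pointwise); hypothesis (3) is then vacuous (`𝓕 f` is continuous) and is omitted; convergence of
the series is part of the conclusion. [cite: Platt2016GRH, Theorem 8.2 p. 3021] -/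
theorem _root_.Literature.NumberTheory.LFunctions.platt2016_theorem82 {f : ℝ → ℂ}
    (hf : Continuous f) (hfi : Integrable f)
    (h1 : Integrable (𝓕 f)) (h2 : BoundedVariationOn (𝓕 f) univ) {A : ℝ} (hA : 0 < A) (t : ℝ) :
    Summable (fun n : ℤ => f (n / A) * Real.sinc (n * π - π * A * t)) ∧
      ‖f t - ∑' n : ℤ, f (n / A) * Real.sinc (n * π - π * A * t)‖
        ≤ 2 * ∫ ξ in (Ioc (-(A / 2)) (A / 2))ᶜ, ‖𝓕 f ξ‖ := by
  obtain ⟨M, hM, hbd⟩ := exists_summable_cell_bound_of_boundedVariationOn h1 h2 hA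
  have e : ∀ n : ℤ, Real.sinc (n * π - π * A * t) = Real.sinc (π * (A * t - n)) := by
    intro n
    rw [← Real.sinc_neg]
    congr 1
    ring
  simp_rw [e]
  exact ⟨(hasSum_sample_mul_sinc_of_cell_bound hf hfi h1 hA hM hbd t).summable,
    norm_sub_tsum_sample_mul_sinc_le_of_cell_bound hf hfi h1 hA hM hbd t⟩

/-! ## Real signals and Platt's normalisation -/

/-- For a real signal the spectrum is Hermitian: `‖𝓕 f(−ξ)‖ = ‖𝓕 f(ξ)‖`. [folklore] -/
private theorem norm_fourier_neg_of_real (g : ℝ → ℝ) (ξ : ℝ) :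
    ‖𝓕 (fun t => (g t : ℂ)) (-ξ)‖ = ‖𝓕 (fun t => (g t : ℂ)) ξ‖ := by
  have : 𝓕 (fun t => (g t : ℂ)) (-ξ) = conj (𝓕 (fun t => (g t : ℂ)) ξ) := by
    rw [Real.fourier_real_eq_integral_exp_smul, Real.fourier_real_eq_integral_exp_smul,
      ← integral_conj]
    congr 1
    funext v
    simp only [smul_eq_mul, map_mul, Complex.conj_ofReal, ← Complex.exp_conj, map_mul,
      Complex.conj_I]
    congr 1
    push_cast
    ring
  rw [this, Complex.norm_conj]

/-- For a real signal, `2 ∫_{ξ ∉ (−A/2, A/2]} ‖𝓕 f‖ = 4 ∫_{A/2}^∞ ‖𝓕 f‖` (`A ≥ 0`). [folklore] -/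
private theorem two_mul_integral_compl_window_of_real (g : ℝ → ℝ)
    (hFi : Integrable (𝓕 (fun t => (g t : ℂ)))) {A : ℝ} (hA : 0 ≤ A) :
    2 * ∫ ξ in (Ioc (-(A / 2)) (A / 2))ᶜ, ‖𝓕 (fun t => (g t : ℂ)) ξ‖
      = 4 * ∫ ξ in Ioi (A / 2), ‖𝓕 (fun t => (g t : ℂ)) ξ‖ := by
  rw [compl_Ioc, setIntegral_union (Iic_disjoint_Ioi (by linarith)) measurableSet_Ioi
    hFi.norm.integrableOn hFi.norm.integrableOn]
  have : ∫ ξ in Iic (-(A / 2)), ‖𝓕 (fun t => (g t : ℂ)) ξ‖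
      = ∫ ξ in Ioi (A / 2), ‖𝓕 (fun t => (g t : ℂ)) ξ‖ := by
    rw [← integral_comp_neg_Ioi]
    simp_rw [norm_fourier_neg_of_real]
  rw [this]
  ring

/-- `f̂(x) = (1/2π) · 𝓕 f (x/2π)`: Platt's transform is Mathlib's at ordinary frequency `x/2π`,
scaled by `1/2π`. [cite: Platt2016GRH, §3 p. 3011] -/
theorem plattFourier_eq (f : ℝ → ℂ) (x : ℝ) :
    ((1 / (2 * π) : ℂ) * ∫ t : ℝ, f t * cexp (-(I * t * x)))
      = (1 / (2 * π) : ℂ) * 𝓕 f (x / (2 * π)) := by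
  rw [Real.fourier_real_eq_integral_exp_smul]
  congr 1
  apply MeasureTheory.integral_congr_ae
  filter_upwards with v
  rw [smul_eq_mul, mul_comm]
  congr 1
  have hπ : (π : ℂ) ≠ 0 := by exact_mod_cast Real.pi_ne_zero
  push_cast
  field_simp

/-- `𝓕 f (ξ) = 2π · f̂(2πξ)`. [cite: Platt2016GRH, §3 p. 3011] -/
theorem fourier_eq_plattFourier (f : ℝ → ℂ) (ξ : ℝ) :
    𝓕 f ξ = (2 * π : ℂ) *
      ((1 / (2 * π) : ℂ) * ∫ t : ℝ, f t * cexp (-(I * t * (2 * π * ξ : ℝ)))) := by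
  have hπ : (π : ℂ) ≠ 0 := by exact_mod_cast Real.pi_ne_zero
  rw [plattFourier_eq, ← mul_assoc, show 2 * π * ξ / (2 * π) = ξ by field_simp]
  field_simp

/-- Band-limitation in Platt's letters implies it in Mathlib's: if `f̂(x) = 0` for `|x| > Ω`
then `𝓕 f (ξ) = 0` for `|ξ| > Ω/2π`. [cite: Platt2016GRH, Theorem 8.1 p. 3020] -/
theorem fourier_eq_zero_of_plattFourier_eq_zero {f : ℝ → ℂ} {Ω : ℝ}
    (h : ∀ x : ℝ, Ω < |x| → ((1 / (2 * π) : ℂ) * ∫ t : ℝ, f t * cexp (-(I * t * x))) = 0) {ξ : ℝ}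
    (hξ : Ω / (2 * π) < |ξ|) :
    𝓕 f ξ = 0 := by
  rw [fourier_eq_plattFourier, h _ ?_, mul_zero]
  rw [abs_mul, abs_of_pos (by positivity)]
  rwa [div_lt_iff₀ (by positivity), mul_comm] at hξ

/-- Hypothesis (1) of Theorem 8.2 in Platt's letters gives it in Mathlib's:
`f̂ ∈ L¹(ℝ) ⇒ 𝓕 f ∈ L¹(ℝ)`. [cite: Platt2016GRH, Theorem 8.2 p. 3021] -/
theorem integrable_fourier_of_plattFourier {f : ℝ → ℂ}
    (h : Integrable (fun x : ℝ => (1 / (2 * π) : ℂ) * ∫ t : ℝ, f t * cexp (-(I * t * x)))) :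
    Integrable (𝓕 f) := by
  have e : 𝓕 f = fun ξ : ℝ => (2 * π : ℂ) *
      (fun x : ℝ => (1 / (2 * π) : ℂ) * ∫ t : ℝ, f t * cexp (-(I * t * x))) (2 * π * ξ) :=
    funext (fourier_eq_plattFourier f)
  rw [e]
  exact (h.comp_mul_left' (by positivity : (2 * π : ℝ) ≠ 0)).const_mul _

/-- Hypothesis (2) of Theorem 8.2 in Platt's letters gives it in Mathlib's:
`f̂` of bounded variation on `ℝ` ⇒ `𝓕 f` of bounded variation on `ℝ`.
[cite: Platt2016GRH, Theorem 8.2 p. 3021] -/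
theorem boundedVariationOn_fourier_of_plattFourier {f : ℝ → ℂ}
    (h : BoundedVariationOn (fun x : ℝ => (1 / (2 * π) : ℂ) * ∫ t : ℝ, f t * cexp (-(I * t * x)))
      univ) : BoundedVariationOn (𝓕 f) univ := by
  have e : 𝓕 f = (fun z : ℂ => (2 * π : ℂ) • z) ∘
      ((fun x : ℝ => (1 / (2 * π) : ℂ) * ∫ t : ℝ, f t * cexp (-(I * t * x))) ∘
        fun ξ : ℝ => 2 * π * ξ) := by
    funext ξ
    simp only [Function.comp_apply, smul_eq_mul]
    exact fourier_eq_plattFourier f ξ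
  rw [e]
  refine (lipschitzWith_smul (2 * π : ℂ)).comp_boundedVariationOn ?_
  refine ne_top_of_le_ne_top h ?_
  exact eVariationOn.comp_le_of_monotoneOn _ (fun ξ : ℝ => 2 * π * ξ)
    (fun a _ b _ hab => by dsimp only; nlinarith [Real.pi_pos]) (mapsTo_univ _ _)

/-- **Platt 2016, Theorem 8.1 as printed** (journal p. 3020): "Let `f(t)` be a continuous,
real-valued function with Fourier Transform `f̂(x)` such that `f̂(x) = 0` for `|x| > A/2 > 0`. Also,
define `sinc(x) := sin(x)/x`. Then `f(t) = Σ_{n ∈ ℤ} f(n/A) sinc(nπ − πAt)`, when this sum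
converges."
Here for complex-valued continuous integrable `f`, with `f̂(x) = (1/2π)∫ f(t)e^{−itx} dt` (the
paper's §3 convention, written out) and the convergence PROVED rather than assumed. (With the §3
angular-frequency
convention the sharp band for spacing `1/A` is `|x| ≤ πA ⊇ |x| ≤ A/2`; the sharp form is
`whittakerShannon_hasSum`.)
[cite: Platt2016GRH, Theorem 8.1 p. 3020 (= arXiv:1305.3087v1 Thm. 6.1)] -/
theorem _root_.Literature.NumberTheory.LFunctions.platt2016_theorem81 {f : ℝ → ℂ}
    (hf : Continuous f) (hfi : Integrable f) {A : ℝ}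
    (hA : 0 < A)
    (hband : ∀ x : ℝ, A / 2 < |x| → ((1 / (2 * π) : ℂ) * ∫ t : ℝ, f t * cexp (-(I * t * x))) = 0)
    (t : ℝ) :
    HasSum (fun n : ℤ => f (n / A) * Real.sinc (n * π - π * A * t)) (f t) := by
  have hband' : ∀ ξ : ℝ, A / 2 < |ξ| → 𝓕 f ξ = 0 := by
    intro ξ hξ
    refine fourier_eq_zero_of_plattFourier_eq_zero hband (lt_of_le_of_lt ?_ hξ)
    rw [div_le_iff₀ (by positivity)]
    nlinarith [Real.pi_gt_three]
  have e : ∀ n : ℤ, Real.sinc (n * π - π * A * t) = Real.sinc (π * (A * t - n)) := by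
    intro n
    rw [← Real.sinc_neg]
    congr 1
    ring
  simp_rw [e]
  exact whittakerShannon_hasSum hA hf hfi hband' t

/-- The right-hand side of Theorem 8.2 in Platt's normalisation: `∫_{πA}^∞ |f̂(x)| dx =
∫_{A/2}^∞ ‖𝓕 f(ξ)‖ dξ` (substitution `x = 2πξ`). [cite: Platt2016GRH, Theorem 8.2 p. 3021] -/
theorem integral_Ioi_norm_plattFourier (f : ℝ → ℂ) (A : ℝ) :
    ∫ x in Ioi (π * A), ‖((1 / (2 * π) : ℂ) * ∫ t : ℝ, f t * cexp (-(I * t * x)))‖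
      = ∫ ξ in Ioi (A / 2), ‖𝓕 f ξ‖ := by
  have h2π : (0 : ℝ) < 2 * π := by positivity
  have e : ∀ ξ : ℝ, ‖𝓕 f ξ‖ = (fun x : ℝ => 2 * π *
      ‖((1 / (2 * π) : ℂ) * ∫ t : ℝ, f t * cexp (-(I * t * x)))‖) (2 * π * ξ) := by
    intro ξ
    dsimp only
    rw [fourier_eq_plattFourier, norm_mul]
    congr 1
    rw [show (2 * π : ℂ) = ((2 * π : ℝ) : ℂ) by push_cast; ring, Complex.norm_real,
      Real.norm_of_nonneg h2π.le]
  simp_rw [e]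
  rw [integral_comp_mul_left_Ioi (fun x : ℝ => 2 * π *
      ‖((1 / (2 * π) : ℂ) * ∫ t : ℝ, f t * cexp (-(I * t * x)))‖) (A / 2) h2π,
    MeasureTheory.integral_const_mul, smul_eq_mul, ← mul_assoc, inv_mul_cancel₀ h2π.ne', one_mul,
    show 2 * π * (A / 2) = π * A by ring]

/-- **Platt 2016, Theorem 8.2 with the printed right-hand side**, for a real signal:
`|f(t) − Σ_{n ∈ ℤ} f(n/A) sinc(nπ − πAt)| ≤ 4 ∫_{πA}^∞ |f̂(x)| dx` with
`f̂(x) = (1/2π)∫ f(t)e^{−itx} dt` written out, under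
(1) `f̂ ∈ L¹` and (2) `f̂` of bounded variation — stated for `𝓕 f`, which is `f̂` up to the
rescaling `x = 2πξ` and the factor `1/2π` (`Upsampling.plattFourier_eq`) — for `f` real-valued,
continuous and
integrable. [cite: Platt2016GRH, Theorem 8.2 p. 3021 (proof: Brown 1967, [5] of the journal)] -/
theorem _root_.Literature.NumberTheory.LFunctions.platt2016_theorem82_real {g : ℝ → ℝ}
    (hg : Continuous g) (hgi : Integrable g)
    (h1 : Integrable (fun x : ℝ => (1 / (2 * π) : ℂ) * ∫ t : ℝ, (g t : ℂ) * cexp (-(I * t * x))))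
    (h2 : BoundedVariationOn
      (fun x : ℝ => (1 / (2 * π) : ℂ) * ∫ t : ℝ, (g t : ℂ) * cexp (-(I * t * x))) univ)
    {A : ℝ} (hA : 0 < A)
    (t : ℝ) :
    Summable (fun n : ℤ => g (n / A) * Real.sinc (n * π - π * A * t)) ∧
      |g t - ∑' n : ℤ, g (n / A) * Real.sinc (n * π - π * A * t)|
        ≤ 4 * ∫ x in Ioi (π * A),
            ‖((1 / (2 * π) : ℂ) * ∫ t : ℝ, (g t : ℂ) * cexp (-(I * t * x)))‖ := by
  have hf : Continuous (fun t => (g t : ℂ)) := Complex.continuous_ofReal.comp hg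
  have hfi : Integrable (fun t => (g t : ℂ)) := hgi.ofReal
  have h1' := integrable_fourier_of_plattFourier (f := fun t => (g t : ℂ)) h1
  obtain ⟨hs, hb⟩ := platt2016_theorem82 hf hfi h1'
    (boundedVariationOn_fourier_of_plattFourier (f := fun t => (g t : ℂ)) h2) hA t
  have hs' : Summable (fun n : ℤ => g (n / A) * Real.sinc (n * π - π * A * t)) := by
    have := (Complex.reCLM.summable hs)
    simpa using this
  refine ⟨hs', ?_⟩
  rw [integral_Ioi_norm_plattFourier, ← two_mul_integral_compl_window_of_real g h1' hA.le]
  refine le_trans (le_of_eq ?_) hb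
  rw [← Real.norm_eq_abs, ← Complex.norm_real]
  congr 1
  push_cast
  rfl

/-! ## Energy of the samples and the truncation error

Platt (p. 3021): "To apply Theorem 8.1 rigorously, we need to examine two sources of error: the
error introduced by truncating the sum [...] dealt with on a case-by-case basis". The generic
certificate for the truncation is Cauchy–Schwarz against the two Parseval identities below. -/

/-- `Σ_{n ∈ ℤ} sinc(π(Tt − n))² = 1` for `T > 0` and every real `t` (Parseval for the kernel
`e^{−2πitξ}` on the window, whose Fourier coefficients are the sinc values).
[cite: Platt2016GRH, §8 p. 3021 (truncation error; Parseval step)] -/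
theorem hasSum_sinc_sq {T : ℝ} (hT : 0 < T) (t : ℝ) :
    HasSum (fun n : ℤ => Real.sinc (π * (T * t - n)) ^ 2) 1 := by
  have hab : -(T / 2) < T / 2 := by linarith
  have hTT : T / 2 - -(T / 2) = T := by ring
  have key := hasSum_sq_fourierCoeffOn hab (memLp_two_cexp_neg t (-(T / 2)) (T / 2))
  simp_rw [fourierCoeffOn_cexp_neg hT t, Complex.norm_real, Real.norm_eq_abs, sq_abs] at key
  have hval : ((T / 2 - -(T / 2))⁻¹ • ∫ ξ in -(T / 2)..(T / 2),
      ‖cexp (-(2 * π * I * t * ξ))‖ ^ 2) = (1 : ℝ) := by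
    have e : ∀ ξ : ℝ, ‖cexp (-(2 * π * I * t * ξ))‖ ^ 2 = 1 := by
      intro ξ
      rw [show -(2 * π * I * t * ξ : ℂ) = ((-(2 * π * t * ξ) : ℝ) : ℂ) * I by push_cast; ring,
        Complex.norm_exp_ofReal_mul_I, one_pow]
    simp_rw [e, intervalIntegral.integral_const, smul_eq_mul, mul_one, hTT]
    field_simp
  rw [hval] at key
  have e : (fun n : ℤ => Real.sinc (π * (T * t + n)) ^ 2)
      = (fun n : ℤ => Real.sinc (π * (T * t - n)) ^ 2) ∘ (Equiv.neg ℤ) := by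
    funext n
    simp only [Function.comp_apply, Equiv.neg_apply, Int.cast_neg, sub_neg_eq_add]
  rw [e] at key
  exact (Equiv.neg ℤ).hasSum_iff.mp key

/-- **Parseval for the samples of a window-limited spectrum**: for `P ∈ L²(−T/2, T/2]` and
`g(t) = ∫_{−T/2}^{T/2} e^{2πitξ} P(ξ) dξ`, `Σ_n ‖g(n/T)‖² = T ∫_{−T/2}^{T/2} ‖P‖²`.
[cite: Platt2016GRH, §8 p. 3021 (truncation error; Parseval step)] -/
theorem hasSum_norm_sq_windowIntegral {T : ℝ} (hT : 0 < T) {P : ℝ → ℂ}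
    (hP : MemLp P 2 (volume.restrict (Ioc (-(T / 2)) (T / 2)))) :
    HasSum (fun n : ℤ => ‖∫ ξ in -(T / 2)..(T / 2), cexp (2 * π * I * (n / T) * ξ) * P ξ‖ ^ 2)
      (T * ∫ ξ in -(T / 2)..(T / 2), ‖P ξ‖ ^ 2) := by
  have hab : -(T / 2) < T / 2 := by linarith
  have hTT : T / 2 - -(T / 2) = T := by ring
  have hT0 : T ≠ 0 := hT.ne'
  set g : ℤ → ℂ := fun n => ∫ ξ in -(T / 2)..(T / 2), cexp (2 * π * I * (n / T) * ξ) * P ξ with hg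
  have key := hasSum_sq_fourierCoeffOn hab hP
  have hcoef : ∀ n : ℤ, ‖fourierCoeffOn hab P n‖ ^ 2 = T⁻¹ ^ 2 * ‖g (-n)‖ ^ 2 := by
    intro n
    have hint : (∫ x in -(T / 2)..(T / 2), (fourier (-n)) (x : AddCircle (T / 2 - -(T / 2))) • P x)
        = g (-n) := by
      rw [hg]
      simp only [Int.cast_neg]
      refine intervalIntegral.integral_congr fun ξ _ => ?_
      simp only [fourier_coe_apply, smul_eq_mul, hTT]
      congr 1
      congr 1
      push_cast
      ring
    rw [fourierCoeffOn_eq_integral P n hab, hint, norm_smul, mul_pow, hTT, Real.norm_eq_abs,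
      abs_of_pos (by positivity), one_div]
  simp_rw [hcoef, hTT, smul_eq_mul] at key
  have key2 := key.mul_left (T ^ 2)
  simp_rw [← mul_assoc, show T ^ 2 * T⁻¹ ^ 2 = 1 by field_simp, one_mul,
    show T ^ 2 * T⁻¹ = T by field_simp] at key2
  have key3 : HasSum ((fun n : ℤ => ‖g n‖ ^ 2) ∘ (Equiv.neg ℤ)) (T * ∫ ξ in -(T / 2)..(T / 2),
      ‖P ξ‖ ^ 2) := key2
  exact (Equiv.neg ℤ).hasSum_iff.mp key3

/-- **Parseval for the samples of a band-limited signal** (hypotheses of Theorem 8.1):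
`Σ_n ‖f(n/T)‖² = T ∫_{−T/2}^{T/2} ‖𝓕 f‖²`.
[cite: Platt2016GRH, §8 p. 3021 (truncation error; Parseval step)] -/
theorem _root_.Literature.NumberTheory.LFunctions.whittakerShannon_hasSum_norm_sq {f : ℝ → ℂ}
    {T : ℝ} (hT : 0 < T) (hf : Continuous f) (hfi : Integrable f)
    (hband : ∀ ξ : ℝ, T / 2 < |ξ| → 𝓕 f ξ = 0) :
    HasSum (fun n : ℤ => ‖f (n / T)‖ ^ 2) (T * ∫ ξ in -(T / 2)..(T / 2), ‖𝓕 f ξ‖ ^ 2) := by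
  obtain ⟨hFL2, hinv⟩ := bandLimited_aux hT hf hfi hband
  have key := hasSum_norm_sq_windowIntegral hT hFL2
  have e : (fun n : ℤ => ‖∫ ξ in -(T / 2)..(T / 2), cexp (2 * π * I * (n / T) * ξ) * 𝓕 f ξ‖ ^ 2)
      = fun n : ℤ => ‖f (n / T)‖ ^ 2 := by
    funext n
    rw [hinv ((n : ℝ) / T)]
    push_cast
    ring_nf
  rwa [e] at key

/-- **Truncation error of the cardinal series** (Platt: the first of the "two sources of error",
"dealt with on a case-by-case basis"; generic Cauchy–Schwarz certificate): for a band-limited `f`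
as in Theorem 8.1 and any finite set `s` of sample indices,
`‖f(t) − Σ_{n ∈ s} f(n/T) sinc(π(Tt − n))‖² ≤ (T∫_{−T/2}^{T/2}‖𝓕 f‖² − Σ_{n∈s}‖f(n/T)‖²) ·
(1 − Σ_{n∈s} sinc(π(Tt − n))²)` — the omitted energy times the omitted sinc mass.
[cite: Platt2016GRH, §8 p. 3021 (truncation error)] -/
theorem _root_.Literature.NumberTheory.LFunctions.whittakerShannon_truncation_sq_le {f : ℝ → ℂ}
    {T : ℝ} (hT : 0 < T) (hf : Continuous f) (hfi : Integrable f)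
    (hband : ∀ ξ : ℝ, T / 2 < |ξ| → 𝓕 f ξ = 0) (t : ℝ) (s : Finset ℤ) :
    ‖f t - ∑ n ∈ s, f (n / T) * Real.sinc (π * (T * t - n))‖ ^ 2
      ≤ (T * (∫ ξ in -(T / 2)..(T / 2), ‖𝓕 f ξ‖ ^ 2) - ∑ n ∈ s, ‖f (n / T)‖ ^ 2) *
        (1 - ∑ n ∈ s, Real.sinc (π * (T * t - n)) ^ 2) := by
  have h1 := (s.hasSum_iff_compl).mp (whittakerShannon_hasSum hT hf hfi hband t)
  have h2 := (s.hasSum_iff_compl).mp (whittakerShannon_hasSum_norm_sq hT hf hfi hband)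
  have h3 := (s.hasSum_iff_compl).mp (hasSum_sinc_sq hT t)
  have hE : 0 ≤ T * (∫ ξ in -(T / 2)..(T / 2), ‖𝓕 f ξ‖ ^ 2) - ∑ n ∈ s, ‖f (n / T)‖ ^ 2 :=
    h2.nonneg fun _ => sq_nonneg _
  have hbound : ∀ u : Finset {x // x ∉ s},
      ‖∑ x ∈ u, f ((x : ℤ) / T) * (Real.sinc (π * (T * t - (x : ℤ))) : ℂ)‖ ^ 2
        ≤ (T * (∫ ξ in -(T / 2)..(T / 2), ‖𝓕 f ξ‖ ^ 2) - ∑ n ∈ s, ‖f (n / T)‖ ^ 2) *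
          (1 - ∑ n ∈ s, Real.sinc (π * (T * t - n)) ^ 2) := by
    intro u
    calc ‖∑ x ∈ u, f ((x : ℤ) / T) * (Real.sinc (π * (T * t - (x : ℤ))) : ℂ)‖ ^ 2
        ≤ (∑ x ∈ u, ‖f ((x : ℤ) / T)‖ * |Real.sinc (π * (T * t - (x : ℤ)))|) ^ 2 := by
          gcongr
          refine (norm_sum_le _ _).trans (le_of_eq ?_)
          refine Finset.sum_congr rfl fun x _ => ?_
          rw [norm_mul, Complex.norm_real, Real.norm_eq_abs]
      _ ≤ (∑ x ∈ u, ‖f ((x : ℤ) / T)‖ ^ 2) *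
            ∑ x ∈ u, |Real.sinc (π * (T * t - (x : ℤ)))| ^ 2 :=
          Finset.sum_mul_sq_le_sq_mul_sq u _ _
      _ ≤ (T * (∫ ξ in -(T / 2)..(T / 2), ‖𝓕 f ξ‖ ^ 2) - ∑ n ∈ s, ‖f (n / T)‖ ^ 2) *
          (1 - ∑ n ∈ s, Real.sinc (π * (T * t - n)) ^ 2) := by
          refine mul_le_mul (sum_le_hasSum u (fun _ _ => sq_nonneg _) h2) ?_
            (Finset.sum_nonneg fun _ _ => sq_nonneg _) hE
          simp_rw [sq_abs]
          exact sum_le_hasSum u (fun _ _ => sq_nonneg _) h3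
  exact le_of_tendsto' ((h1.norm).pow 2) hbound

end Upsampling

end Literature.NumberTheory.LFunctions
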